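import Summits.HodgeConjecture.HodgeCM.Model.HypCensus.PlaceDatum_1

/-! PORT of `HodgeCM/Model/HypCensus/PlaceDatum.lean` (HodgeCMPerL run 82) — part 2: continuation of `Summits.HodgeConjecture.HodgeCM.Model.HypCensus.PlaceDatum_1` (split at a top-level declaration boundary by port_pkg.py; scope re-opened below; declarations unchanged). -/

-- port_pkg: scope re-opened for this part (file-level context, then the namespace/section stack open at the cut)
set_option autoImplicit false
noncomputable section
open scoped TensorProduct Classical
open MvPolynomial NumberField NumberField.InfinitePlace Complex
open Literature.Analysis.SegalBargmann Literature.NumberTheory.Weil1964 Literature.NumberTheory.Automorphic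
open Literature.RepresentationTheory (atPlace)
open Literature.RepresentationTheory.KonnoKonno2007 Literature.RepresentationTheory.KonnoKonno2007.RealDualPair
open HodgeCM.PerL34.Fock HodgeCM.PerL34.Fock.PrintDict
namespace HodgeCM.Model.HypCensus
namespace PlaceDatum
variable {L : Type} [Field L] [NumberField L] [IsCMField L]
variable {dV : Fin 3 → L} {hdV : ∀ i, IsCMField.complexConj L (dV i) = dV i}
variable {dW : Fin 2 → L} {hdW : ∀ i, IsCMField.complexConj L (dW i) = dW i}
variable {ι₁ : L →+* ℂ} {v : {v : InfinitePlace ↥(maximalRealSubfield L) // v.IsReal}}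
/-- **the place of `ι₁`** with its variable identification (no direction; the obligations are vacuous). -/
def iota (j : PlaneVar → Fin 6) : PlaceDatum L dV hdV dW hdW ι₁ v where
  kind := .iota
  lam := -((Real.pi : ℂ))⁻¹
  lam_ne_zero := neg_inv_pi_ne_zero
  idx := j
  r₀ := fun u => nomatch u
  s₀ := fun u => nomatch u
  slot_shape := fun u => nomatch u
  hyp_dict := fun u => nomatch u

/-- (Ported verbatim from the HodgeCMPerL package; no docstring in the source.) -/
@[simp] theorem sigmaPos_kind (eA : Fin 3 ≃ PosIdx (cmXV L dV hdV ι₁ v)) (hQ : IsEmpty (NegIdx (cmXV L dV hdV ι₁ v)))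
    (r₀ : PosIdx (cmXW L dV dW hdW ι₁ v)) (s₀ : NegIdx (cmXW L dV dW hdW ι₁ v))
    (hR : Subsingleton (PosIdx (cmXW L dV dW hdW ι₁ v))) (hS : Subsingleton (NegIdx (cmXW L dV dW hdW ι₁ v))) :
    (sigmaPos eA hQ r₀ s₀ hR hS).kind = .sigma := rfl

/-- (Ported verbatim from the HodgeCMPerL package; no docstring in the source.) -/
@[simp] theorem sigmaNeg_kind (eA : Fin 3 ≃ NegIdx (cmXV L dV hdV ι₁ v)) (hP : IsEmpty (PosIdx (cmXV L dV hdV ι₁ v)))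
    (r₀ : PosIdx (cmXW L dV dW hdW ι₁ v)) (s₀ : NegIdx (cmXW L dV dW hdW ι₁ v))
    (hR : Subsingleton (PosIdx (cmXW L dV dW hdW ι₁ v))) (hS : Subsingleton (NegIdx (cmXW L dV dW hdW ι₁ v))) :
    (sigmaNeg eA hP r₀ s₀ hR hS).kind = .sigma := rfl

/-- (Ported verbatim from the HodgeCMPerL package; no docstring in the source.) -/
@[simp] theorem sigmaPosSwap_kind (eA : Fin 3 ≃ PosIdx (cmXV L dV hdV ι₁ v)) (hQ : IsEmpty (NegIdx (cmXV L dV hdV ι₁ v)))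
    (r₀ : PosIdx (cmXW L dV dW hdW ι₁ v)) (s₀ : NegIdx (cmXW L dV dW hdW ι₁ v))
    (hR : Subsingleton (PosIdx (cmXW L dV dW hdW ι₁ v))) (hS : Subsingleton (NegIdx (cmXW L dV dW hdW ι₁ v))) :
    (sigmaPosSwap eA hQ r₀ s₀ hR hS).kind = .sigmaSwap := rfl

/-- (Ported verbatim from the HodgeCMPerL package; no docstring in the source.) -/
@[simp] theorem sigmaNegSwap_kind (eA : Fin 3 ≃ NegIdx (cmXV L dV hdV ι₁ v)) (hP : IsEmpty (PosIdx (cmXV L dV hdV ι₁ v)))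
    (r₀ : PosIdx (cmXW L dV dW hdW ι₁ v)) (s₀ : NegIdx (cmXW L dV dW hdW ι₁ v))
    (hR : Subsingleton (PosIdx (cmXW L dV dW hdW ι₁ v))) (hS : Subsingleton (NegIdx (cmXW L dV dW hdW ι₁ v))) :
    (sigmaNegSwap eA hP r₀ s₀ hR hS).kind = .sigmaSwap := rfl

/-- (Ported verbatim from the HodgeCMPerL package; no docstring in the source.) -/
@[simp] theorem delta_kind (j : EqVar → Fin 6) : (delta j : PlaceDatum L dV hdV dW hdW ι₁ v).kind = .delta := rfl

/-- (Ported verbatim from the HodgeCMPerL package; no docstring in the source.) -/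
@[simp] theorem iota_kind (j : PlaneVar → Fin 6) : (iota j : PlaceDatum L dV hdV dW hdW ι₁ v).kind = .iota := rfl

variable (vac : Circle × Circle →* Circle)

/-- **the embedding of the printed local κ-part of the place into `ℂ[z_{Fin 6}]`**: the inclusion into the polynomial model followed
by the variable identification. -/
def emb (d : PlaceDatum L dV hdV dW hdW ι₁ v) : (printLoc d.lam d.lam_ne_zero vac d.kind).M →ₗ[ℂ] MvPolynomial (Fin 6) ℂ :=
  (rename d.idx).toLinearMap ∘ₗ kindIncl d.lam d.lam_ne_zero vac d.kind

/-- (Ported verbatim from the HodgeCMPerL package; no docstring in the source.) -/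
theorem emb_apply (d : PlaceDatum L dV hdV dW hdW ι₁ v) (x : (printLoc d.lam d.lam_ne_zero vac d.kind).M) :
    d.emb vac x = rename d.idx (kindIncl d.lam d.lam_ne_zero vac d.kind x) := rfl

/-- **LEMMA A — the hyperbolic dictionary at the place, for EVERY datum**: Konno–Konno's `W`-side boost generator of the direction
`u` acts on the inserted printed vector by the printed slot operator `hypLoc … u`. -/
theorem hypOpWGen_binvPi_emb (d : PlaceDatum L dV hdV dW hdW ι₁ v) (u : HypIdx d.kind)
    (x : (printLoc d.lam d.lam_ne_zero vac d.kind).M) :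
    hypOpWGen (PosIdx (cmXV L dV hdV ι₁ v)) (NegIdx (cmXV L dV hdV ι₁ v)) (d.r₀ u) (d.s₀ u)
        (binvPi (rename (cmIdx L dV hdV dW hdW ι₁ v) (d.emb vac x))) =
      binvPi (rename (cmIdx L dV hdV dW hdW ι₁ v) (d.emb vac (hypLoc d.lam d.lam_ne_zero vac d.kind u x))) := by
  rw [emb_apply, emb_apply]
  exact d.hyp_dict u vac x

end PlaceDatum

end HodgeCM.Model.HypCensus

end
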